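import Summits.ValiantsHypothesis.ValiantsHypothesis.Theses.SOSTau
import Summits.ValiantsHypothesis.ValiantsHypothesis.Theorems.SOSTauHutchinsonMagnification

/-!
# `SOSTau` is summit-strength on route `SOSTau` (crux-strategist r1 certificate)

Route `route-ValiantsHypothesis-SOSTau` has the deciding theorem
`closes : SOSTau → HutchinsonMagnification → ValiantsHypothesis` (route file, sorry-free) and its
second crux `HutchinsonMagnification` (item stmt-ValiantsHypothesis-18749) is PROVED in the tree
(`Theorems.SOSTauHutchinsonMagnification.HutchinsonMagnification_proof`, commit abfb5286bc99).
Hence the single remaining open crux `SOSTau` (item stmt-ValiantsHypothesis-18748 = Dutta 2021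
Conj. 1 = Bürgisser 2024 Conj. 4.2, printed open) implies the summit outright: in the tribunal's
T1 sense the crux is `≥ S` (C ⇒ S certified; no converse is known or expected — `SOSTau` is a
statement about real zeros of univariate sparse sums of squares, `ValiantsHypothesis` is
`VP_ℂ ≠ VNP_ℂ`).

This file records that implication as a named theorem so the tribunal can cite it by name.
It also records the factorisation through the route's target `HutchinsonSOSHard`
(item stmt-ValiantsHypothesis-18747), which is the natural re-target: the strategist census
(Cruxes/SOSTau/STRATEGY-CENSUS.md, Transfer (route level)) shows the target already follows from
the strictly weaker slice `NegRootedSOS` (glue `Census2.target_of_negRooted`, Cruxes/SOSTau/CensusSketch2.lean).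
-/

set_option linter.dupNamespace false

namespace Summit.ValiantsHypothesis.ValiantsHypothesis.Theorems.SOSTauSummitStrength

open Summit.ValiantsHypothesis.ValiantsHypothesis.Theses.SOSTau

/-- **Summit strength of the crux.** With `HutchinsonMagnification` proved, `SOSTau` alone
implies `ValiantsHypothesis` (`VP_ℂ ≠ VNP_ℂ`). -/
theorem valiantsHypothesis_of_sosTau : SOSTau → _root_.ValiantsHypothesis := fun h =>
  closes h Theorems.SOSTauHutchinsonMagnification.HutchinsonMagnification_proof

/-- The same implication factored through the route's target: `SOSTau` gives the linear
support-sum lower bound for real weighted-SOS representations of Tavenas' `V_n`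
(with `η = 1/(2(c+1))`, `n₀ = 1`), i.e. the body of `HutchinsonSOSHard`. -/
theorem hutchinsonSOSHard_of_sosTau : SOSTau → HutchinsonSOSHard := by
  rintro ⟨c, hc⟩
  refine ⟨1 / (2 * ((c : ℝ) + 1)), by positivity, 1, fun n hn s a g hrep => ?_⟩
  have hZ := hc s a g
  rw [hrep, Literature.Computability.AlgebraicComplexity.card_roots_toFinset_map_tavenasV] at hZ
  have h1 : (1 : ℕ) ≤ 2 ^ n := Nat.one_le_two_pow
  have hZ' : (2 : ℝ) ^ n - 1 ≤ (c : ℝ) * ∑ i, ((g i).support.card : ℝ) := by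
    have := (Nat.cast_le (α := ℝ)).mpr hZ
    push_cast [Nat.cast_sub h1] at this
    exact this
  have h2 : (2 : ℝ) ≤ 2 ^ n := by
    calc (2 : ℝ) = 2 ^ 1 := by norm_num
      _ ≤ 2 ^ n := pow_le_pow_right₀ (by norm_num) hn
  have hS : 0 ≤ ∑ i, ((g i).support.card : ℝ) := by positivity
  rw [div_mul_eq_mul_div, one_mul, div_le_iff₀ (by positivity)]
  nlinarith [mul_nonneg (Nat.cast_nonneg c) hS]

/-- Sanity: the summit-strength theorem is literally `closes` with its proved second binder. -/
example : SOSTau → _root_.ValiantsHypothesis := fun h =>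
  Theorems.SOSTauHutchinsonMagnification.HutchinsonMagnification_proof (hutchinsonSOSHard_of_sosTau h)

end Summit.ValiantsHypothesis.ValiantsHypothesis.Theorems.SOSTauSummitStrength
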